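import Summits.Ventures.CertifiedQuantumChemistry.Rows.SectorRows
import Summits.Ventures.CertifiedQuantumChemistry.Rows.DifferenceRows
import Summits.Ventures.CertifiedQuantumChemistry.Rows.SectorEnergyConcavity
import Literature.MathematicalPhysics.QuantumChemistry.SectorEnergyPerturbationBounds
import HarnessLib

/-!
# Ventures/CertifiedQuantumChemistry — Rows/DifferencePencilRows.lean: SOUNDNESS of the direct
# difference certificates `dE-direct:d` (energy-window / pencil) and `dE-direct:b` (continuation)
# — a lower certificate for the COMBINED table file `c·F_A − F_B` plus one absolute row of `F_A`
# proves a difference row `DiffLowerRow F_A a b F_B a b …` of `Rows/DifferenceRows.lean`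

HONEST FRAMING (verbatim): certified bounds for a stated model Hamiltonian in a stated basis; not a
claim about the real molecule or material beyond that model.

Typer chem-type-09 (LADDER-CHEM I-TYPE slot 09, cell chem-oracle; director-chem pointer P1 class (d),
LADDER-CHEM.md v1.2 §7.4; ORACLE-SPEC §1.3 (ii) `dE-direct:<class>`; REFEREE-CHEM §1.4 «I-DIFF-cert
with a NAMED typed decl»). The pair `(F_A, F_B)` lives on ONE orbital space `Fin k` and ONE sector
`(N_α, N_β) = (a, b)` (the load-bearing hypothesis of class (d), director D-3); `V := H_A − H_B`.

## The certificate and why it is sound (two lines of mathematics, `Literature/…/SectorEnergyPerturbationBounds`)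
For every real `c`, the sector ground state `ψ_A` of `H_A` is a trial state for `c·H_A − H_B` and for
`H_B`, so `E₀(c·H_A − H_B; a, b) ≤ c·E₀(A) − E₀(B)` (`sectorGroundEnergy_real_smul_sub_le`), i.e.
  `E₀(A) − E₀(B) ≥ E₀(c·H_A − H_B; a, b) − (c − 1)·E₀(A)`.
The operator `c·H_A − H_B` IS the model Hamiltonian of the exact-rational table file
`c·F_A − F_B` (`Model.lincomb c (−1) F_A F_B`, `Model.hamiltonian_pencil`: the second-quantised map is
linear in the tables), so its sector energy is bounded below by an ORDINARY lower certificate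
(FORMAT-qcl1, any condition string, replayed A∧B as for absolute rows: `LowerCertificate` →
`LowerRow` of `Rows/SectorRows.lean`); the remaining term is closed by an absolute row of `F_A`:
an UPPER row `E₀(A) ≤ u_A` when `c ≥ 1` (`diffLowerRow_of_pencil_of_upperRow`: `ΔE_L = ℓ − (c−1)·u_A`),
a LOWER row `l_A ≤ E₀(A)` when `c ≤ 1` (`diffLowerRow_of_pencil_of_lowerRow`: `ΔE_L = ℓ + (1−c)·l_A`).
Exchanging the roles of `A` and `B` gives the UPPER difference rows (`diffUpperRow_of_pencil_of_…`).
`c = 1` is Weyl's inequality `E₀(H_A − H_B) ≤ E₀(A) − E₀(B) ≤ −E₀(H_B − H_A)`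
(`diffLowerRow_of_lowerRow_sub`, `diffUpperRow_of_lowerRow_sub`: no absolute row needed at all).

## Reading as the ENERGY-WINDOW EXPECTATION SDP (director P1 (d); Han 2020 eq. (ob); Wang et al. 2024)
`m_A := min {Tr[V·Γ] : Γ relaxation-feasible in the sector, Tr[H_A·Γ] ≤ u_A} ≤ ΔE`. Its Lagrangian
in the window constraint with multiplier `μ ≥ 0` is `min_Γ Tr[(V + μH_A)Γ] − μu_A =
OPT((1+μ)H_A − H_B) − μ·u_A`, i.e. exactly the bound of `diffLowerRow_of_pencil_of_upperRow` with
`c = 1 + μ` and `ℓ` = the certified value of the relaxation for the combined file (weak duality; with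
strong duality the best `c` reproduces `m_A`). So a `dE-direct:d` certificate is NOTHING NEW IN FORMAT:
(i) a rational `c ≥ 1` (the window multiplier + 1, read off the windowed solve and then fixed),
(ii) a FORMAT-qcl1 lower certificate for the table file `c·F_A − F_B` in sector `(a, b)`,
(iii) a FORMAT-qcu0 upper certificate for `F_A` in `(a, b)` (`diffLowerRow_of_pencil_certificates`);
and symmetrically `(c′, qcl1 for c′·F_B − F_A, qcu0 for F_B)` for the upper side. The variant with
`c ≤ 1` and a LOWER row of `F_A` is the multiplier of the redundant-looking constraint
`Tr[H_A·Γ] ≥ l_A`, useful when `l_A` comes from a TIGHTER relaxation than the combined solve.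

## Class (b), continuation in λ (certnum-sdp-3 DESIGN-box §4; chem-lit-1 F-D1)
The segment `F(s) = (1 − s)·F_B + s·F_A = Model.lincomb (1 − s) s F_B F_A` has Hamiltonian
`H_B + s·V` (`Model.hamiltonian_segment`); `s ↦ E₀(F(s); a, b)` is concave, so its secant slopes are
non-increasing (`Model.energy_segment_slope_anti`). A λ-grid refinement of the difference is the CHAIN
(`DiffLowerRow.trans` / `DiffUpperRow.trans` of `Rows/DifferenceRows.lean`) of per-segment pencil rows
between consecutive grid models `F(s_i)`, `F(s_{i+1})` — each an instance of the theorems of this file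
with `(F_A, F_B) := (F(s_{i+1}), F(s_i))`; no further soundness statement is needed for (b).

What is NOT here: class (a) joint SDP over two SECTORS of one file (vertical IP/EA/spin gaps; director
D-3 (i)) and class (c) common-fragment locality reductions — not yet worded by chem-solver-4; any
certificate instance, number, or claim node. Nothing in this file asserts a bound about any file.
-/

noncomputable section

namespace Summit.Ventures.CertifiedQuantumChemistry

open Matrix Finset
open Literature.MathematicalPhysics.QuantumLattice Literature.MathematicalPhysics.QuantumChemistry
open scoped ComplexOrder

/-! ## §1 Exact-rational linear combinations of two models on one orbital space -/

namespace Model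

variable {k : ℕ}

/-- **The combined table file `α·F + β·G`** of two models on the same `k` orbitals: one- and
two-electron tables and core constant combined entrywise with exact rational coefficients
(`α = c`, `β = −1` is the PENCIL file `c·F_A − F_B` of a `dE-direct:d` certificate; `α = 1 − s`,
`β = s` is the point `s` of the SEGMENT from `F` … to `G` of class (b)). A referee regenerates it
from the two pinned files; its `model_sha256` is a function of theirs and of `(α, β)`. -/
def lincomb (α β : ℚ) (F G : Model k) : Model k where
  h p q := α * F.h p q + β * G.h p q
  eri p q r s := α * F.eri p q r s + β * G.eri p q r s
  ecore := α * F.ecore + β * G.ecore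

/-- The combined file inherits the integral symmetries of its two constituents (so its Hamiltonian
is Hermitian and `lowerRow_of_certificate` applies to it). -/
theorem lincomb_isSymmetric {α β : ℚ} {F G : Model k} (hF : F.IsSymmetric) (hG : G.IsSymmetric) :
    (lincomb α β F G).IsSymmetric :=
  ⟨fun p q => by simp only [lincomb, hF.1 p q, hG.1 p q],
    fun p q r s => by simp only [lincomb, hF.2 p q r s, hG.2 p q r s]⟩

/-- Scaling all tables scales the second-quantised Hamiltonian:
`Ĥ(s·T) = s·Ĥ(T)` (the case `T₀ = 0` of `molecularHamiltonian_line`). -/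
theorem molecularHamiltonian_smul {Λ : Type*} [LinearOrder Λ] [Fintype Λ] (s : ℂ)
    (h : Λ → Λ → ℂ) (g : Λ → Λ → Λ → Λ → ℂ) (c : ℂ) :
    molecularHamiltonian (s • h) (s • g) (s * c) = s • molecularHamiltonian h g c := by
  have h0 : molecularHamiltonian (0 : Λ → Λ → ℂ) (0 : Λ → Λ → Λ → Λ → ℂ) 0 = 0 := by
    simp [molecularHamiltonian]
  have hl := molecularHamiltonian_line 0 h 0 g 0 c s
  rwa [zero_add, zero_add, zero_add, h0, zero_add] at hl

/-- **The second-quantised map is linear in the tables**: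
`Ĥ(α·F + β·G) = α·Ĥ(F) + β·Ĥ(G)` as operators on the Fock space of the `2k` spin orbitals. -/
theorem hamiltonian_lincomb (α β : ℚ) (F G : Model k) :
    (lincomb α β F G).hamiltonian = (α : ℂ) • F.hamiltonian + (β : ℂ) • G.hamiltonian := by
  have eh : (fun p q => (((lincomb α β F G).h p q : ℚ) : ℂ)) =
      (α : ℂ) • (fun p q => (F.h p q : ℂ)) + (β : ℂ) • (fun p q => (G.h p q : ℂ)) := by
    funext p q
    simp only [lincomb, Pi.add_apply, Pi.smul_apply, smul_eq_mul, Rat.cast_add, Rat.cast_mul]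
  have eg : (fun p q r s => (((lincomb α β F G).eri p q r s : ℚ) : ℂ)) =
      (α : ℂ) • (fun p q r s => (F.eri p q r s : ℂ)) +
        (β : ℂ) • (fun p q r s => (G.eri p q r s : ℂ)) := by
    funext p q r s
    simp only [lincomb, Pi.add_apply, Pi.smul_apply, smul_eq_mul, Rat.cast_add, Rat.cast_mul]
  have ec : (((lincomb α β F G).ecore : ℚ) : ℂ) = (α : ℂ) * (F.ecore : ℂ) + (β : ℂ) * (G.ecore : ℂ) := by
    simp only [lincomb, Rat.cast_add, Rat.cast_mul]
  rw [show (lincomb α β F G).hamiltonian = molecularHamiltonian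
      (fun p q => (((lincomb α β F G).h p q : ℚ) : ℂ))
      (fun p q r s => (((lincomb α β F G).eri p q r s : ℚ) : ℂ))
      (((lincomb α β F G).ecore : ℚ) : ℂ) from rfl,
    eh, eg, ec, molecularHamiltonian_line, molecularHamiltonian_smul]
  rfl

/-- **The pencil file's Hamiltonian**: `Ĥ(c·F − G) = c·Ĥ(F) − Ĥ(G)` (real scalar form, as consumed
by `sectorGroundEnergy_real_smul_sub_le`). -/
theorem hamiltonian_pencil (c : ℚ) (F G : Model k) :
    (lincomb c (-1) F G).hamiltonian = ((c : ℝ) : ℂ) • F.hamiltonian - G.hamiltonian := by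
  rw [hamiltonian_lincomb, Complex.ofReal_ratCast, Rat.cast_neg, Rat.cast_one, neg_one_smul,
    sub_eq_add_neg]

/-- **The segment file's Hamiltonian**: `Ĥ((1 − s)·G + s·F) = Ĥ(G) + s·(Ĥ(F) − Ĥ(G))` — the point
`s` of the straight line in table space from `G` (`s = 0`) to `F` (`s = 1`) (class (b)). -/
theorem hamiltonian_segment (s : ℚ) (F G : Model k) :
    (lincomb (1 - s) s G F).hamiltonian =
      G.hamiltonian + ((s : ℝ) : ℂ) • (F.hamiltonian - G.hamiltonian) := by
  rw [hamiltonian_lincomb, Complex.ofReal_ratCast, Rat.cast_sub, Rat.cast_one, sub_smul, one_smul,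
    smul_sub]
  abel

/-- **THE PENCIL INEQUALITY FOR MODELS** (the one line of mathematics behind `dE-direct:d`): for
symmetric models `F`, `G` on the same `k` orbitals, a sector `a, b ≤ k` and every rational `c`,
`E₀(c·F − G; a, b) ≤ c·E₀(F; a, b) − E₀(G; a, b)` (`sectorGroundEnergy_real_smul_sub_le`: the sector
ground state of `Ĥ(F)` is a trial state for `Ĥ(c·F − G)` and for `Ĥ(G)`). -/
theorem energy_pencil_le {F G : Model k} (hF : F.IsSymmetric) (hG : G.IsSymmetric) {a b : ℕ}
    (ha : a ≤ k) (hb : b ≤ k) (c : ℚ) :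
    (lincomb c (-1) F G).energy a b ≤ (c : ℝ) * F.energy a b - G.energy a b := by
  simp only [Model.energy]
  rw [hamiltonian_pencil]
  exact sectorGroundEnergy_real_smul_sub_le (Model.hamiltonian_isHermitian hF)
    (Model.hamiltonian_isHermitian hG) (molecularHamiltonian_commute_totalNumber _ _ _)
    (molecularHamiltonian_commute_spinZ _ _ _) (by simpa using ha) (by simpa using hb) (c : ℝ)

/-- **Secant slopes of `s ↦ E₀((1 − s)·G + s·F; a, b)` are non-increasing** (class (b): the exact
sector energy is CONCAVE along the segment; `sectorGroundEnergy_pencil_slope_anti`). For rational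
`s₀ < s₁ < s₂`: `(E(s₂) − E(s₁))/(s₂ − s₁) ≤ (E(s₁) − E(s₀))/(s₁ − s₀)`. -/
theorem energy_segment_slope_anti {F G : Model k} (hF : F.IsSymmetric) (hG : G.IsSymmetric)
    {a b : ℕ} (ha : a ≤ k) (hb : b ≤ k) {s₀ s₁ s₂ : ℚ} (h₀₁ : s₀ < s₁) (h₁₂ : s₁ < s₂) :
    ((lincomb (1 - s₂) s₂ G F).energy a b - (lincomb (1 - s₁) s₁ G F).energy a b) /
        ((s₂ : ℝ) - s₁) ≤
      ((lincomb (1 - s₁) s₁ G F).energy a b - (lincomb (1 - s₀) s₀ G F).energy a b) /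
        ((s₁ : ℝ) - s₀) := by
  simp only [Model.energy]
  rw [hamiltonian_segment, hamiltonian_segment, hamiltonian_segment]
  exact sectorGroundEnergy_pencil_slope_anti (Model.hamiltonian_isHermitian hG)
    ((Model.hamiltonian_isHermitian hF).sub (Model.hamiltonian_isHermitian hG))
    (by simpa using ha) (by simpa using hb) (by exact_mod_cast h₀₁) (by exact_mod_cast h₁₂)

end Model

/-! ## §2 `dE-direct:d` — LOWER difference rows from a pencil lower row and one absolute row of `F_A` -/

variable {k : ℕ}

/-- **`dE-direct:d`, LOWER side, window multiplier `c ≥ 1`.** For symmetric `F_A`, `F_B` on the same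
`k` orbitals and one sector `(a, b)`: a certified lower row `ℓ ≤ E₀(c·F_A − F_B; a, b)` for the
combined file and a certified upper row `E₀(A) ≤ u_A` give
`ℓ − (c − 1)·u_A ≤ E₀(A) − E₀(B)`, i.e. `DiffLowerRow F_A a b F_B a b (ℓ − (c − 1)·u_A)`.
(`c = 1 + μ`, `μ ≥ 0` the multiplier of the energy window `Tr[H_A Γ] ≤ u_A`; director P1 (d).) -/
theorem diffLowerRow_of_pencil_of_upperRow {FA FB : Model k} (hA : FA.IsSymmetric)
    (hB : FB.IsSymmetric) {a b : ℕ} {c ℓ uA : ℚ} (hc : 1 ≤ c)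
    (hP : LowerRow (Model.lincomb c (-1) FA FB) a b ℓ) (hU : UpperRow FA a b uA) :
    DiffLowerRow FA a b FB a b (ℓ - (c - 1) * uA) := by
  obtain ⟨ha, hb, hℓ⟩ := hP
  have hpen := Model.energy_pencil_le hA hB ha hb c
  have hu := hU.le
  have hc' : (0 : ℝ) ≤ (c : ℝ) - 1 := by exact_mod_cast sub_nonneg.2 hc
  have hmul := mul_le_mul_of_nonneg_left hu hc'
  refine ⟨⟨ha, hb⟩, ⟨ha, hb⟩, ?_⟩
  push_cast
  linarith

/-- **`dE-direct:d`, LOWER side, multiplier `c ≤ 1`.** A certified lower row `ℓ ≤ E₀(c·F_A − F_B)`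
and a certified LOWER row `l_A ≤ E₀(A)` give `ℓ + (1 − c)·l_A ≤ E₀(A) − E₀(B)` (the multiplier of the
constraint `Tr[H_A Γ] ≥ l_A`; informative when `l_A` is tighter than the combined relaxation). -/
theorem diffLowerRow_of_pencil_of_lowerRow {FA FB : Model k} (hA : FA.IsSymmetric)
    (hB : FB.IsSymmetric) {a b : ℕ} {c ℓ lA : ℚ} (hc : c ≤ 1)
    (hP : LowerRow (Model.lincomb c (-1) FA FB) a b ℓ) (hL : LowerRow FA a b lA) :
    DiffLowerRow FA a b FB a b (ℓ + (1 - c) * lA) := by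
  obtain ⟨ha, hb, hℓ⟩ := hP
  have hpen := Model.energy_pencil_le hA hB ha hb c
  have hl := hL.le
  have hc' : (0 : ℝ) ≤ 1 - (c : ℝ) := by exact_mod_cast sub_nonneg.2 hc
  have hmul := mul_le_mul_of_nonneg_left hl hc'
  refine ⟨⟨ha, hb⟩, ⟨ha, hb⟩, ?_⟩
  push_cast
  linarith

/-- **Weyl's inequality as a difference certificate (`c = 1`): no absolute row needed.** A certified
lower row `ℓ ≤ E₀(F_A − F_B; a, b)` for the DIFFERENCE file alone gives `ℓ ≤ E₀(A) − E₀(B)`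
(`E₀(H_B) + λ_min(V) ≤ E₀(H_B + V)`, Horn–Johnson (4.3.16)). -/
theorem diffLowerRow_of_lowerRow_sub {FA FB : Model k} (hA : FA.IsSymmetric) (hB : FB.IsSymmetric)
    {a b : ℕ} {ℓ : ℚ} (hP : LowerRow (Model.lincomb 1 (-1) FA FB) a b ℓ) :
    DiffLowerRow FA a b FB a b ℓ := by
  obtain ⟨ha, hb, hℓ⟩ := hP
  have hpen := Model.energy_pencil_le hA hB ha hb 1
  refine ⟨⟨ha, hb⟩, ⟨ha, hb⟩, ?_⟩
  push_cast at hpen ⊢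
  linarith

/-- **`dE-direct:d` straight from the certificate predicates of `Rows/SectorRows.lean`** (what the
readers A/B replay): a FORMAT-qcl1 lower certificate for the combined file `c·F_A − F_B` (`c ≥ 1`)
and a FORMAT-qcu0 upper certificate for `F_A`, both in sector `(a, b)` with `a, b ≤ k`, give the
difference lower row `ℓ − (c − 1)·u_A ≤ E₀(A) − E₀(B)`. -/
theorem diffLowerRow_of_pencil_certificates {FA FB : Model k} (hA : FA.IsSymmetric)
    (hB : FB.IsSymmetric) {a b : ℕ} (ha : a ≤ k) (hb : b ≤ k) {c ℓ uA : ℚ} (hc : 1 ≤ c)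
    (hP : LowerCertificate (Model.lincomb c (-1) FA FB) a b ℓ) (hU : UpperCertificate FA a b uA) :
    DiffLowerRow FA a b FB a b (ℓ - (c - 1) * uA) :=
  diffLowerRow_of_pencil_of_upperRow hA hB hc
    (lowerRow_of_certificate (Model.lincomb_isSymmetric hA hB) ha hb hP) (upperRow_of_certificate hA hU)

/-! ## §3 `dE-direct:d` — UPPER difference rows (the roles of `A` and `B` exchanged) -/

/-- **`dE-direct:d`, UPPER side, window multiplier `c ≥ 1`.** A certified lower row
`ℓ ≤ E₀(c·F_B − F_A; a, b)` for the combined file with the roles exchanged and a certified upper row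
`E₀(B) ≤ u_B` give `E₀(A) − E₀(B) ≤ (c − 1)·u_B − ℓ` (the B-window bounds `ΔE` from ABOVE,
director D-2 / chem-ref-4). -/
theorem diffUpperRow_of_pencil_of_upperRow {FA FB : Model k} (hA : FA.IsSymmetric)
    (hB : FB.IsSymmetric) {a b : ℕ} {c ℓ uB : ℚ} (hc : 1 ≤ c)
    (hP : LowerRow (Model.lincomb c (-1) FB FA) a b ℓ) (hU : UpperRow FB a b uB) :
    DiffUpperRow FA a b FB a b ((c - 1) * uB - ℓ) := by
  have h := (diffLowerRow_iff_diffUpperRow_swap FB a b FA a b _).1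
    (diffLowerRow_of_pencil_of_upperRow hB hA hc hP hU)
  rwa [neg_sub] at h

/-- **`dE-direct:d`, UPPER side, multiplier `c ≤ 1`.** `ℓ ≤ E₀(c·F_B − F_A; a, b)` and a LOWER row
`l_B ≤ E₀(B)` give `E₀(A) − E₀(B) ≤ −(ℓ + (1 − c)·l_B)`. -/
theorem diffUpperRow_of_pencil_of_lowerRow {FA FB : Model k} (hA : FA.IsSymmetric)
    (hB : FB.IsSymmetric) {a b : ℕ} {c ℓ lB : ℚ} (hc : c ≤ 1)
    (hP : LowerRow (Model.lincomb c (-1) FB FA) a b ℓ) (hL : LowerRow FB a b lB) :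
    DiffUpperRow FA a b FB a b (-(ℓ + (1 - c) * lB)) :=
  (diffLowerRow_iff_diffUpperRow_swap FB a b FA a b _).1
    (diffLowerRow_of_pencil_of_lowerRow hB hA hc hP hL)

/-- **Weyl's inequality, upper side (`c = 1`)**: a certified lower row `ℓ ≤ E₀(F_B − F_A; a, b)` for
the reversed difference file gives `E₀(A) − E₀(B) ≤ −ℓ` (`E₀(H_B + V) ≤ E₀(H_B) + λ_max(V)`). -/
theorem diffUpperRow_of_lowerRow_sub {FA FB : Model k} (hA : FA.IsSymmetric) (hB : FB.IsSymmetric)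
    {a b : ℕ} {ℓ : ℚ} (hP : LowerRow (Model.lincomb 1 (-1) FB FA) a b ℓ) :
    DiffUpperRow FA a b FB a b (-ℓ) :=
  (diffLowerRow_iff_diffUpperRow_swap FB a b FA a b _).1 (diffLowerRow_of_lowerRow_sub hB hA hP)

/-- **`dE-direct:d` upper side straight from the certificate predicates**: a FORMAT-qcl1 lower
certificate for `c·F_B − F_A` (`c ≥ 1`) and a FORMAT-qcu0 upper certificate for `F_B` give
`E₀(A) − E₀(B) ≤ (c − 1)·u_B − ℓ`. -/
theorem diffUpperRow_of_pencil_certificates {FA FB : Model k} (hA : FA.IsSymmetric)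
    (hB : FB.IsSymmetric) {a b : ℕ} (ha : a ≤ k) (hb : b ≤ k) {c ℓ uB : ℚ} (hc : 1 ≤ c)
    (hP : LowerCertificate (Model.lincomb c (-1) FB FA) a b ℓ) (hU : UpperCertificate FB a b uB) :
    DiffUpperRow FA a b FB a b ((c - 1) * uB - ℓ) :=
  diffUpperRow_of_pencil_of_upperRow hA hB hc
    (lowerRow_of_certificate (Model.lincomb_isSymmetric hB hA) ha hb hP) (upperRow_of_certificate hB hU)

/-! ## §4 Two-sided `dE-direct` brackets -/

/-- **THE TWO-SIDED `dE-direct:d` BRACKET.** Two windowed pencil certificates — `(c_A ≥ 1, ℓ_A ≤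
E₀(c_A·F_A − F_B), E₀(A) ≤ u_A)` for the lower side and `(c_B ≥ 1, ℓ_B ≤ E₀(c_B·F_B − F_A),
E₀(B) ≤ u_B)` for the upper side — give the certified difference bracket
`ℓ_A − (c_A − 1)·u_A ≤ E₀(A) − E₀(B) ≤ (c_B − 1)·u_B − ℓ_B`. Its width is set by the two window
slacks and the spread of `V = H_A − H_B` over near-optimal relaxation points, NOT by `W_A + W_B`
(LADDER-CHEM §7.4); whether it passes `DiffWidthBeatsAbsolutes` is chem-solver-4's STEP-0 question. -/
theorem diffBracket_of_pencils {FA FB : Model k} (hA : FA.IsSymmetric) (hB : FB.IsSymmetric)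
    {a b : ℕ} {cA ℓA uA cB ℓB uB : ℚ} (hcA : 1 ≤ cA) (hcB : 1 ≤ cB)
    (hPA : LowerRow (Model.lincomb cA (-1) FA FB) a b ℓA) (hUA : UpperRow FA a b uA)
    (hPB : LowerRow (Model.lincomb cB (-1) FB FA) a b ℓB) (hUB : UpperRow FB a b uB) :
    DiffBracket FA a b FB a b (ℓA - (cA - 1) * uA) ((cB - 1) * uB - ℓB) :=
  ⟨diffLowerRow_of_pencil_of_upperRow hA hB hcA hPA hUA,
    diffUpperRow_of_pencil_of_upperRow hA hB hcB hPB hUB⟩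

/-- **The Weyl bracket (`c = 1` on both sides)**: lower certificates for the two difference files
`F_A − F_B` and `F_B − F_A` alone give `ℓ ≤ E₀(A) − E₀(B) ≤ −ℓ′`
(`[λ_min(V|sector), λ_max(V|sector)]`; the bracket of class (c) when `V` is a local fragment change). -/
theorem diffBracket_of_lowerRows_sub {FA FB : Model k} (hA : FA.IsSymmetric) (hB : FB.IsSymmetric)
    {a b : ℕ} {ℓ ℓ' : ℚ} (hP : LowerRow (Model.lincomb 1 (-1) FA FB) a b ℓ)
    (hP' : LowerRow (Model.lincomb 1 (-1) FB FA) a b ℓ') : DiffBracket FA a b FB a b ℓ (-ℓ') :=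
  ⟨diffLowerRow_of_lowerRow_sub hA hB hP, diffUpperRow_of_lowerRow_sub hA hB hP'⟩

end Summit.Ventures.CertifiedQuantumChemistry

end
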